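import Summits.CriticalPhenomena.PercolationContinuityZ3.Theorems.PercNearOneGluingNoHeavyLowerTailAntipodalR1TwoCutTransfer
import Summits.CriticalPhenomena.PercolationContinuityZ3.Theorems.PercNearOneGluingNoHeavyLowerTailAntipodalR1NestedGraded
import HarnessLib

/-!
# ANTI₁ across a 2-separation, VI: component counts (towards the graded reduction)

Support file for `stmt-CriticalPhenomena-4575` (memo `prim-gen-kcluster/KCLUSTER-gen76.md` §2 "grades add";
conjecture ANTI₁-GRADED of `KCLUSTER-gen52.md` §3).  No definitions, no named facts, no sorries.  Vocabulary
of `AntipodalR1` (gen 62), the grade conventions of `…AntipodalR1NestedGraded` (the `col`-coloured graph of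
a colouring `x` of `ends : ι → Sym2 V` is `SimpleGraph.fromEdgeSet {s | ∃ e, x e = col ∧ ends e = s}` on
`V`, and the grade is the total number of connected components of the two coloured graphs), and parts
I–II of the 2-cut reduction (gen 78).

**Abstract counting lemma** (`card_cc_add_card_eq`).  Let `H, H', H₂` be simple graphs on a finite
vertex type and `I` a set of vertices such that (i) `H` and `H'` have the same reachability between
vertices outside `I`, (ii) the vertices of `I` are isolated in `H'`, (iii) `H₂ ≤ H` carries every edge
of `H` at a vertex of `I`.  Then
`#CC(H) + #I = #CC(H') + #{components of H₂ inside I}`.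

**Glued systems** (`card_cc_glued_add_eq`, `card_cc_glued_add_eq_inl`).  For `G = G₁ ∪ G₂` glued along
`{u, v}` and the gadget system `G' = G₁ ∪ P_κ` with the same state (part II), for each colour:
`#CC_col(G, ω) + #I = #CC_col(G', ω') + c_col(ω₂)`, where `I` is the set of interior vertices of `G₂`
and `c_col(ω₂)` — the number of `col`-clusters of `G₂` consisting of interior vertices — depends only
on the colouring `ω₂` of `G₂` and is symmetric under the colour swap (`c_true(ω̄₂) = c_false(ω₂)`,
`card_ccInside_flip`).  Hence the grade of `ω` exceeds the grade of `ω'` by `c(ω₂) − 2·#I`, a quantity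
that is constant on fibres and swap-invariant: the graded form of the 2-cut reduction follows fibrewise
exactly as the ungraded one (sequel).  [this work]
-/

namespace Summit.CriticalPhenomena.PercolationContinuityZ3.Theorems

namespace AntipodalR1

open Finset Relation SimpleGraph

variable {V : Type*}

section Abstract

/-- An isolated vertex is reachable only from itself. [this work] -/
theorem eq_of_reachable_isolated {H : SimpleGraph V} {w x : V} (hiso : ∀ z, ¬ H.Adj w z)
    (h : H.Reachable w x) : x = w := by
  obtain ⟨p⟩ := h
  cases p with
  | nil => rfl
  | cons hadj _ => exact (hiso _ hadj).elim

/-- Every connected component has a representative (in `connectedComponentMk` form). [this work] -/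
theorem exists_rep_cc {H : SimpleGraph V} (C : H.ConnectedComponent) :
    ∃ v, H.connectedComponentMk v = C :=
  Quot.exists_rep C

/-- Splitting the components into those meeting the complement of `I` and those inside `I`.
[this work] -/
theorem card_cc_eq_meeting_add_inside [Finite V] (H : SimpleGraph V) (I : Set V) :
    Nat.card H.ConnectedComponent =
      Nat.card {C : H.ConnectedComponent // ∃ x, x ∉ I ∧ H.connectedComponentMk x = C} +
        Nat.card {C : H.ConnectedComponent // ¬ ∃ x, x ∉ I ∧ H.connectedComponentMk x = C} := by
  classical
  rw [← Nat.card_sum]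
  exact Nat.card_congr (Equiv.sumCompl fun C : H.ConnectedComponent =>
    ∃ x, x ∉ I ∧ H.connectedComponentMk x = C).symm

/-- Two graphs with the same reachability off `I` have equally many components meeting the complement
of `I`. [this work] -/
theorem card_cc_meeting_eq (H H' : SimpleGraph V) (I : Set V)
    (hreach : ∀ x y, x ∉ I → y ∉ I → (H.Reachable x y ↔ H'.Reachable x y)) :
    Nat.card {C : H.ConnectedComponent // ∃ x, x ∉ I ∧ H.connectedComponentMk x = C} =
      Nat.card {C : H'.ConnectedComponent // ∃ x, x ∉ I ∧ H'.connectedComponentMk x = C} := by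
  classical
  refine Nat.card_congr
    { toFun := fun C => ⟨H'.connectedComponentMk C.2.choose, C.2.choose, C.2.choose_spec.1, rfl⟩
      invFun := fun C => ⟨H.connectedComponentMk C.2.choose, C.2.choose, C.2.choose_spec.1, rfl⟩
      left_inv := ?_
      right_inv := ?_ }
  · rintro ⟨C, hC⟩
    apply Subtype.ext
    simp only
    generalize_proofs h₂
    obtain ⟨hx, hxC⟩ := hC.choose_spec
    obtain ⟨hy, hyC⟩ := h₂.choose_spec
    exact (ConnectedComponent.sound
      ((hreach _ _ hy hx).2 (ConnectedComponent.exact hyC))).trans hxC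
  · rintro ⟨C, hC⟩
    apply Subtype.ext
    simp only
    generalize_proofs h₂
    obtain ⟨hx, hxC⟩ := hC.choose_spec
    obtain ⟨hy, hyC⟩ := h₂.choose_spec
    exact (ConnectedComponent.sound
      ((hreach _ _ hy hx).1 (ConnectedComponent.exact hyC))).trans hxC

/-- If the vertices of `I` are isolated, the components inside `I` are the vertices of `I`.
[this work] -/
theorem card_cc_inside_eq_card_of_isolated (H' : SimpleGraph V) (I : Set V)
    (hiso : ∀ w ∈ I, ∀ z, ¬ H'.Adj w z) :
    Nat.card {C : H'.ConnectedComponent // ¬ ∃ x, x ∉ I ∧ H'.connectedComponentMk x = C} =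
      Nat.card I := by
  classical
  have hrepI : ∀ C : H'.ConnectedComponent, (¬ ∃ x, x ∉ I ∧ H'.connectedComponentMk x = C) →
      (exists_rep_cc C).choose ∈ I := by
    intro C hC
    by_contra h
    exact hC ⟨_, h, (exists_rep_cc C).choose_spec⟩
  refine Nat.card_congr
    { toFun := fun C => ⟨(exists_rep_cc C.1).choose, hrepI C.1 C.2⟩
      invFun := fun w => ⟨H'.connectedComponentMk w.1, fun ⟨x, hxI, hx⟩ => hxI (by
        rw [eq_of_reachable_isolated (hiso w.1 w.2) (ConnectedComponent.exact hx).symm]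
        exact w.2)⟩
      left_inv := ?_
      right_inv := ?_ }
  · rintro ⟨C, hC⟩
    exact Subtype.ext (exists_rep_cc C).choose_spec
  · rintro ⟨w, hw⟩
    apply Subtype.ext
    exact eq_of_reachable_isolated (hiso w hw)
      (ConnectedComponent.exact (exists_rep_cc (H'.connectedComponentMk w)).choose_spec).symm

/-- A walk of `H` from a vertex of `I` all of whose `H₂`-reachable vertices lie in `I` stays inside
`I` and is an `H₂`-reachability, when `H₂` carries every edge of `H` at `I`. [this work] -/
theorem reachable_sub_of_walk {H H₂ : SimpleGraph V} {I : Set V}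
    (hI : ∀ w ∈ I, ∀ z, H.Adj w z → H₂.Adj w z) {w x : V} (p : H.Walk w x) (hw : w ∈ I)
    (hwI : ∀ y, H₂.Reachable w y → y ∈ I) : x ∈ I ∧ H₂.Reachable w x := by
  induction p with
  | nil => exact ⟨hw, Reachable.refl _⟩
  | @cons w z x hadj p ih =>
    have hwz : H₂.Reachable w z := (hI w hw z hadj).reachable
    have hz : z ∈ I := hwI z hwz
    obtain ⟨hx, hzx⟩ := ih hz (fun y hy => hwI y (hwz.trans hy))
    exact ⟨hx, hwz.trans hzx⟩

/-- The components of `H` inside `I` are the components of `H₂` inside `I`, when `H₂ ≤ H` carries every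
edge of `H` at `I`. [this work] -/
theorem card_cc_inside_eq_of_sub (H H₂ : SimpleGraph V) (I : Set V) (hle : H₂ ≤ H)
    (hI : ∀ w ∈ I, ∀ z, H.Adj w z → H₂.Adj w z) :
    Nat.card {C : H.ConnectedComponent // ¬ ∃ x, x ∉ I ∧ H.connectedComponentMk x = C} =
      Nat.card {D : H₂.ConnectedComponent // ¬ ∃ x, x ∉ I ∧ H₂.connectedComponentMk x = D} := by
  classical
  -- inside components of `H₂`: every `H`-reachable vertex stays inside and `H₂`-reachable
  have key : ∀ w, (¬ ∃ x, x ∉ I ∧ H₂.connectedComponentMk x = H₂.connectedComponentMk w) →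
      ∀ x, H.Reachable w x → x ∈ I ∧ H₂.Reachable w x := by
    intro w hw x hwx
    have hwI : ∀ y, H₂.Reachable w y → y ∈ I := by
      intro y hy
      by_contra hyI
      exact hw ⟨y, hyI, ConnectedComponent.sound hy.symm⟩
    obtain ⟨p⟩ := hwx
    exact reachable_sub_of_walk hI p (hwI w (Reachable.refl _)) hwI
  refine Nat.card_congr
    { toFun := fun C => ⟨H₂.connectedComponentMk (exists_rep_cc C.1).choose, fun ⟨x, hxI, hx⟩ =>
        C.2 ⟨x, hxI, by
          rw [← (exists_rep_cc C.1).choose_spec]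
          exact ConnectedComponent.sound ((ConnectedComponent.exact hx).mono hle)⟩⟩
      invFun := fun D => ⟨H.connectedComponentMk (exists_rep_cc D.1).choose, fun ⟨x, hxI, hx⟩ =>
        hxI (key _ (by rw [(exists_rep_cc D.1).choose_spec]; exact D.2) x
          (ConnectedComponent.exact hx).symm).1⟩
      left_inv := ?_
      right_inv := ?_ }
  · rintro ⟨C, hC⟩
    apply Subtype.ext
    simp only
    generalize_proofs h₁ h₂
    exact (ConnectedComponent.sound ((ConnectedComponent.exact h₂.choose_spec).mono hle)).trans
      h₁.choose_spec
  · rintro ⟨D, hD⟩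
    apply Subtype.ext
    simp only
    generalize_proofs h₁ h₂
    have hD' : ¬ ∃ x, x ∉ I ∧ H₂.connectedComponentMk x = H₂.connectedComponentMk h₁.choose := by
      rw [h₁.choose_spec]; exact hD
    exact (ConnectedComponent.sound
      (key _ hD' _ (ConnectedComponent.exact h₂.choose_spec).symm).2.symm).trans h₁.choose_spec

/-- **Abstract counting lemma.**  If `H` and `H'` have the same reachability off `I`, the vertices of
`I` are isolated in `H'`, and `H₂ ≤ H` carries every edge of `H` at `I`, then
`#CC(H) + #I = #CC(H') + #{components of H₂ inside I}`. [this work] -/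
theorem card_cc_add_card_eq [Finite V] (H H' H₂ : SimpleGraph V) (I : Set V)
    (hreach : ∀ x y, x ∉ I → y ∉ I → (H.Reachable x y ↔ H'.Reachable x y))
    (hiso : ∀ w ∈ I, ∀ z, ¬ H'.Adj w z) (hle : H₂ ≤ H)
    (hI : ∀ w ∈ I, ∀ z, H.Adj w z → H₂.Adj w z) :
    Nat.card H.ConnectedComponent + Nat.card I =
      Nat.card H'.ConnectedComponent +
        Nat.card {D : H₂.ConnectedComponent // ¬ ∃ x, x ∉ I ∧ H₂.connectedComponentMk x = D} := by
  rw [card_cc_eq_meeting_add_inside H I, card_cc_eq_meeting_add_inside H' I,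
    card_cc_meeting_eq H H' I hreach, card_cc_inside_eq_card_of_isolated H' I hiso,
    card_cc_inside_eq_of_sub H H₂ I hle hI]
  ring

end Abstract

section Glued

variable {ι ι₁ ι₂ κ : Type*}

/-- Reachability in the coloured graph is membership in the coloured cluster. [this work] -/
theorem reachable_iff_mem_clus {ends : ι → Sym2 V} {x : ι → Bool} {col : Bool} {a v : V} :
    (fromEdgeSet {s : Sym2 V | ∃ e, x e = col ∧ ends e = s}).Reachable a v ↔ v ∈ clus ends x col a := by
  constructor
  · rintro ⟨p⟩
    rw [mem_clus]
    induction p with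
    | nil => exact ReflTransGen.refl
    | cons hadj _ ih =>
      rw [fromEdgeSet_adj] at hadj
      obtain ⟨⟨e, he, hends⟩, -⟩ := hadj
      exact ReflTransGen.head (⟨e, he, hends⟩ : _ ∈ nbr ends x col _) ih
  · exact fun h => reachable_of_mem_clus h

variable {ends₁ : ι₁ → Sym2 V} {ends₂ : ι₂ → Sym2 V} {u v : V}
  {ω : ι₁ ⊕ ι₂ → Bool} {ω' : ι₁ ⊕ κ → Bool}

/-- An edge of the glued system at an interior vertex of `G₂` is an edge of `G₂`. [this work] -/
theorem adj₂_of_adj_interior (hsep : ∀ w i, w ∈ ends₁ i → ∀ j, w ∈ ends₂ j → w = u ∨ w = v)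
    {col : Bool} {w z : V} (hw : ¬ ∀ j, w ∈ ends₂ j → w = u ∨ w = v)
    (h : (fromEdgeSet {s : Sym2 V | ∃ e, ω e = col ∧ Sum.elim ends₁ ends₂ e = s}).Adj w z) :
    (fromEdgeSet {s : Sym2 V | ∃ j, ω (Sum.inr j) = col ∧ ends₂ j = s}).Adj w z := by
  rw [fromEdgeSet_adj] at h ⊢
  obtain ⟨⟨e, he, hends⟩, hne⟩ := h
  cases e with
  | inl i =>
    exact (hw (hsep w i (by rw [show ends₁ i = s(w, z) from hends]; exact Sym2.mem_mk_left _ _))).elim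
  | inr j => exact ⟨⟨j, he, hends⟩, hne⟩

variable [Finite V]

/-- **Component count across a 2-separation (gadget system).**  For `G = G₁ ∪ G₂` glued along `{u, v}`
and the gadget system `G' = G₁ ∪ P_κ` coloured with the same state (agreeing on `G₁`), for each colour:
`#CC_col(G, ω) + #I = #CC_col(G', ω') + c_col(ω₂)`, with `I` the interior vertices of `G₂` and
`c_col(ω₂)` the number of `col`-components of `G₂` (on `V`) made of interior vertices. [this work] -/
theorem card_cc_glued_add_eq
    (hsep : ∀ w i, w ∈ ends₁ i → ∀ j, w ∈ ends₂ j → w = u ∨ w = v)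
    (hω : ∀ i, ω (Sum.inl i) = ω' (Sum.inl i))
    (hst : ∀ col, v ∈ clus ends₂ (fun j => ω (Sum.inr j)) col u ↔ (u = v ∨ ∃ k, ω' (Sum.inr k) = col))
    (col : Bool) :
    Nat.card (fromEdgeSet {s : Sym2 V | ∃ e, ω e = col ∧ Sum.elim ends₁ ends₂ e = s}).ConnectedComponent +
      Nat.card {w : V | ¬ ∀ j, w ∈ ends₂ j → w = u ∨ w = v} =
    Nat.card (fromEdgeSet {s : Sym2 V | ∃ e, ω' e = col ∧
        Sum.elim ends₁ (fun _ : κ => s(u, v)) e = s}).ConnectedComponent +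
      Nat.card {D : (fromEdgeSet {s : Sym2 V | ∃ j, ω (Sum.inr j) = col ∧ ends₂ j = s}).ConnectedComponent //
        ¬ ∃ x, x ∉ {w : V | ¬ ∀ j, w ∈ ends₂ j → w = u ∨ w = v} ∧
          (fromEdgeSet {s : Sym2 V | ∃ j, ω (Sum.inr j) = col ∧ ends₂ j = s}).connectedComponentMk x = D} := by
  refine card_cc_add_card_eq _ _ _ _ ?_ ?_ ?_ ?_
  · -- same reachability off `I`: the cluster correspondence of part II
    intro x y hx hy
    simp only [Set.mem_setOf_eq, not_not] at hx hy
    rw [reachable_iff_mem_clus, reachable_iff_mem_clus]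
    exact mem_clus_iff_gadget hsep hx hω hst hy
  · -- interior vertices are isolated in `G'`
    intro w hw z h
    simp only [Set.mem_setOf_eq] at hw
    rw [fromEdgeSet_adj] at h
    obtain ⟨⟨e, -, hends⟩, -⟩ := h
    cases e with
    | inl i => exact hw (hsep w i (by rw [show ends₁ i = s(w, z) from hends]; exact Sym2.mem_mk_left _ _))
    | inr k =>
      have h' : s(u, v) = s(w, z) := hends
      exact hw fun _ _ => (Sym2.mem_iff.1 (h' ▸ Sym2.mem_mk_left w z : w ∈ s(u, v)))
  · -- `G₂ ≤ G`
    exact fromEdgeSet_mono fun s ⟨j, hj, hends⟩ => ⟨Sum.inr j, hj, hends⟩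
  · intro w hw z h
    exact adj₂_of_adj_interior hsep hw h

/-- **Component count across a 2-separation (bare side).**  If `u, v` are joined inside `G₂` by no
`col`-path, then `#CC_col(G, ω) + #I = #CC_col(G₁, ω|_{G₁}) + c_col(ω₂)`. [this work] -/
theorem card_cc_glued_add_eq_inl
    (hsep : ∀ w i, w ∈ ends₁ i → ∀ j, w ∈ ends₂ j → w = u ∨ w = v) {col : Bool}
    (hst : v ∉ clus ends₂ (fun j => ω (Sum.inr j)) col u) :
    Nat.card (fromEdgeSet {s : Sym2 V | ∃ e, ω e = col ∧ Sum.elim ends₁ ends₂ e = s}).ConnectedComponent +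
      Nat.card {w : V | ¬ ∀ j, w ∈ ends₂ j → w = u ∨ w = v} =
    Nat.card (fromEdgeSet {s : Sym2 V | ∃ i, ω (Sum.inl i) = col ∧ ends₁ i = s}).ConnectedComponent +
      Nat.card {D : (fromEdgeSet {s : Sym2 V | ∃ j, ω (Sum.inr j) = col ∧ ends₂ j = s}).ConnectedComponent //
        ¬ ∃ x, x ∉ {w : V | ¬ ∀ j, w ∈ ends₂ j → w = u ∨ w = v} ∧
          (fromEdgeSet {s : Sym2 V | ∃ j, ω (Sum.inr j) = col ∧ ends₂ j = s}).connectedComponentMk x = D} := by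
  refine card_cc_add_card_eq _ _ _ _ ?_ ?_ ?_ ?_
  · intro x y hx hy
    simp only [Set.mem_setOf_eq, not_not] at hx hy
    rw [reachable_iff_mem_clus, reachable_iff_mem_clus]
    exact mem_clus_iff_inl_of_not_joined hsep hx hst hy
  · intro w hw z h
    simp only [Set.mem_setOf_eq] at hw
    rw [fromEdgeSet_adj] at h
    obtain ⟨⟨i, -, hends⟩, -⟩ := h
    exact hw (hsep w i (by rw [hends]; exact Sym2.mem_mk_left _ _))
  · exact fromEdgeSet_mono fun s ⟨j, hj, hends⟩ => ⟨Sum.inr j, hj, hends⟩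
  · intro w hw z h
    exact adj₂_of_adj_interior hsep hw h

omit [Finite V] in
/-- The open graph of the swapped colouring is the closed graph of the original one. [this work] -/
theorem colGraph_flip (ends₂ : ι₂ → Sym2 V) (ω₂ : ι₂ → Bool) (col : Bool) :
    (fromEdgeSet {s : Sym2 V | ∃ j, (fun j => !ω₂ j) j = col ∧ ends₂ j = s}) =
      fromEdgeSet {s : Sym2 V | ∃ j, ω₂ j = !col ∧ ends₂ j = s} := by
  congr 1
  ext s
  simp only [Set.mem_setOf_eq]
  constructor
  · rintro ⟨j, hj, he⟩
    exact ⟨j, by rw [← hj, Bool.not_not], he⟩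
  · rintro ⟨j, hj, he⟩
    exact ⟨j, by rw [hj, Bool.not_not], he⟩

end Glued

end AntipodalR1

end Summit.CriticalPhenomena.PercolationContinuityZ3.Theorems
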